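import Summits.QuantumFields.YangMills.Theorems.BalabanLadderIRColdPressurePincer
import Summits.QuantumFields.YangMills.Theorems.BalabanLadderIRAbstractBasinRung24
import HarnessLib

/-!
# `BalabanLadder.IR` (stmt-QuantumFields-19354), ideator line `cofinal-leaf` — support 4/4:
# the gap in units ON THE SET OF EXITING COUPLINGS (per-β seams; no coupling-axis transport)

Support file for the crux item stmt-QuantumFields-19354 (`Summit.QuantumFields.YangMills.Theses.BalabanLadder.IR`),
ideator seat `ym-ir-idea-12` (lens «wuc», generation 2).  HONEST FRAMING: nothing about Yang–Mills is asserted; the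
mass gap / `YangMills` is NOT proved by any of this.

WHAT (all per-β bookkeeping over landed seams; no definition, no sorry).
* `gapOn_of_coldPressure_pinned_on` — the tree's rate seam `ColdPressurePincer.gapInUnits_of_coldPressure_pinned` with
  the onset hypothesis given on a SET of couplings `Bset` only (`∀ β ∈ Bset, β₂ ≤ β → ∃ ξ ≥ 1, ColdPressureAt r.ρ β ξ`):
  conclusion = the `GapInUnits` family of bounds on `Bset` (one rate `1/T`, species constants free of `β`).  Same proof
  with the binder `β ∈ Bset →`.
* `exists_coldPressureAt_of_coldDefect_le` — PER-β ONSET FROM ONE EXIT: at any `β ≥ 0`, one cold `4:1` torus of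
  half-side `L ≥ 8` with purity defect `coldDefect r.ρ β L ≤ 1/24` gives an admissible cold-pressure length
  (`BasinRung.abstractBasin_24_epsStar` on Wilson's axis-symmetric trace-positive family, then
  `coldDefect_sq_le_two_pow` + `ColdPurityBridge.coldPressureAt_of_exit_recursion`; group-blind, the proof of
  `coldPressureOnsetSC_of_exitAt` read at one coupling).
* `gapOn_exitSet_of_af` — THE COFINAL BILL'S KERNEL: for compact simple `G`, any `r`, any positive unit map `a → 0` with
  `LowerBounds G r a`, the AF pin `AFToColdPressure` gives the `GapInUnits` family ON THE SET OF EXITING COUPLINGS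
  `{β | 0 ≤ β ∧ ∃ L ≥ 8, coldDefect r.ρ β L ≤ 1/24}` (pincer `cp_pinned` + the two items above).  If that set is cofinal
  (line K1 `ExitsUnboundedAt (1/24)` of `coupling-clopen`), support 3/4 (`yangMills_of_cofinalLegs`) consumes it: NO
  statement about the couplings in between (no `ExitScaleTameSC` / `DefectLipschitzSC`) is needed for the summit.
[folklore]
-/

set_option autoImplicit false

noncomputable section

open Filter Topology MeasureTheory
open scoped SchwartzMap
open Literature.MathematicalPhysics.QuantumFieldTheory Literature.MathematicalPhysics.QuantumLattice
open Summit.QuantumFields.YangMills.Cruxes.OSLegsFromFemtoAndGap.DlrCollarTransfer (GapInUnits LowerBounds Q2)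
open Literature.MathematicalPhysics.QuantumFieldTheory.Balaban1983to89.Sufficient (ColdPressureBound)
open Summit.QuantumFields.YangMills.Theorems.WeakCouplingHypercubicLimit.TraceNormColdPressure
  (abs_latticeConnectedCorr_le_of_coldPressure)
open Summit.QuantumFields.YangMills.Cruxes.IR.FluxCodeBlindness (volumeFloor_eventually)
open Summit.QuantumFields.YangMills.Cruxes.IR.ColdPurityBridge
open Summit.QuantumFields.YangMills.Cruxes.IR.AspectBootstrap
open Summit.QuantumFields.YangMills.Cruxes.IR.BasinRung (epsStar abstractBasin_24_epsStar)

namespace Summit.QuantumFields.YangMills.Cruxes.IR.ColdPressurePincer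

variable {G : Type} [Group G] [TopologicalSpace G] [IsTopologicalGroup G] [CompactSpace G]
  [MeasurableSpace G] [BorelSpace G]

/-! ## §1 The rate seam with onset on a set of couplings -/

/-- **Rate seam on a set of couplings** (`gapInUnits_of_coldPressure_pinned` with `hon` on `Bset` only; same constants). -/
theorem gapOn_of_coldPressure_pinned_on (r : LatticeRep G) (a : ℝ → ℝ) (ha : ∀ β, 0 < a β)
    (ha0 : Tendsto a atTop (𝓝 0)) {β₂ : ℝ} (Bset : Set ℝ)
    (hon : ∀ β ∈ Bset, β₂ ≤ β → ∃ ξ : ℕ, 1 ≤ ξ ∧ ColdPressureAt r.ρ β ξ)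
    {T β₆ : ℝ} (hpin : ∀ β : ℝ, β₆ ≤ β → a β * (cpLength r.ρ β : ℝ) < T) :
    ∃ (c₁ β₂ : ℝ) (S₁ : ℝ → ℕ), 0 < c₁ ∧ ∀ A B : YMSpecies G, ∃ C : ℝ, ∀ β ∈ Bset, β₂ ≤ β →
      ∀ S n : ℕ, S₁ β ≤ S → n ≤ S →
        |latticeConnectedCorr r.ρ β (2 * S + 1) A.F B.F n| ≤ C * Real.exp (-(c₁ * a β * n)) := by
  classical
  -- `T > 0`
  have hT : 0 < T := by
    have h1 := hpin (max β₂ β₆) (le_max_right _ _)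
    have h0 : 0 ≤ a (max β₂ β₆) * (cpLength r.ρ (max β₂ β₆) : ℝ) :=
      mul_nonneg (ha _).le (Nat.cast_nonneg _)
    linarith
  -- eventually `a β ≤ T`
  obtain ⟨β₇, hβ₇⟩ : ∃ β₇ : ℝ, ∀ β : ℝ, β₇ ≤ β → a β ≤ T := by
    have hev : ∀ᶠ β in atTop, a β < T := ha0.eventually (gt_mem_nhds hT)
    obtain ⟨β₇, h⟩ := Filter.eventually_atTop.1 hev
    exact ⟨β₇, fun β hβ => (h β hβ).le⟩
  set β₈ : ℝ := max (max β₂ β₆) (max β₇ 0) with hβ₈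
  -- the per-β package at the uniform rate `a β / T`
  have hR : ∀ β : ℝ, β ∈ Bset → β₈ ≤ β → ∃ S₂ : ℕ, ∃ C₀ : ℝ, 0 ≤ C₀ ∧
      (∀ S : ℕ, S₂ ≤ S → C₀ * ((2 * S + 1 : ℕ) : ℝ) ^ 3 * Real.exp (-(a β / T * S / 2)) ≤ 1) ∧
      (∀ S : ℕ, S₂ ≤ S → ∀ m : ℕ, S + 1 ≤ 2 * (m + 2) →
        traceExcess r.ρ β (2 * S + 1) (m + 2) ≤
          C₀ * ((2 * S + 1 : ℕ) : ℝ) ^ 3 * Real.exp (-(a β / T * ((m + 2 : ℕ) : ℝ)))) := by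
    intro β hβmem hβ
    have hβ2 : β₂ ≤ β := le_trans (le_trans (le_max_left _ _) (le_max_left _ _)) hβ
    have hβ6 : β₆ ≤ β := le_trans (le_trans (le_max_right _ _) (le_max_left _ _)) hβ
    obtain ⟨ξ, hξ, hcp⟩ := hon β hβmem hβ2
    obtain ⟨h1, hcpL⟩ := cpLength_spec r.ρ β ⟨ξ, hξ, hcp⟩
    obtain ⟨C₀, S₁, hC₀, hP⟩ := hcpL
    have hμ0 : 0 < a β / T := div_pos (ha β) hT
    obtain ⟨S₀, hS₀⟩ := Filter.eventually_atTop.1 (volumeFloor_eventually C₀ (a β / T) hC₀ hμ0)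
    refine ⟨max S₁ S₀, C₀, hC₀, fun S hS => hS₀ S (le_trans (le_max_right _ _) hS), fun S hS m hm => ?_⟩
    have hP1 := hP S (le_trans (le_max_left _ _) hS) m hm
    refine hP1.trans ?_
    have hV : 0 ≤ C₀ * ((2 * S + 1 : ℕ) : ℝ) ^ 3 := by positivity
    refine mul_le_mul_of_nonneg_left (Real.exp_le_exp.2 ?_) hV
    have hξpos : (0 : ℝ) < (cpLength r.ρ β : ℝ) := by exact_mod_cast h1
    have hm0 : (0 : ℝ) ≤ ((m + 2 : ℕ) : ℝ) := Nat.cast_nonneg _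
    have hpinβ : a β * (cpLength r.ρ β : ℝ) < T := hpin β hβ6
    have hrate : a β / T ≤ 1 / (cpLength r.ρ β : ℝ) := by
      rw [div_le_div_iff₀ hT hξpos]
      linarith
    have hmul : a β / T * ((m + 2 : ℕ) : ℝ) ≤ 1 / (cpLength r.ρ β : ℝ) * ((m + 2 : ℕ) : ℝ) :=
      mul_le_mul_of_nonneg_right hrate hm0
    linarith
  -- the size threshold `S₁ β` (junk `0` below `β₈`)
  let S₁ : ℝ → ℕ := fun β => if h : β ∈ Bset ∧ β₈ ≤ β then Classical.choose (hR β h.1 h.2) else 0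
  refine ⟨1 / T, β₈, S₁, by positivity, fun A B => ?_⟩
  obtain ⟨CA, hCA⟩ := A.bounded
  obtain ⟨CB, hCB⟩ := B.bounded
  obtain ⟨w, hw⟩ := abs_latticeConnectedCorr_le_of_coldPressure r A B hCA hCB
  refine ⟨max (CA * CB * Real.exp (2 * w) * (2 + 4 * 1 + 1 ^ 2)) (2 * (CA * CB) * Real.exp (2 * w)),
    fun β hβmem hβ S n hS hn => ?_⟩
  have hS₁ : S₁ β = Classical.choose (hR β hβmem hβ) := dif_pos ⟨hβmem, hβ⟩
  obtain ⟨C₀, hC₀, hK, hP⟩ := Classical.choose_spec (hR β hβmem hβ)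
  rw [hS₁] at hS
  have hβ0 : 0 ≤ β := le_trans (le_trans (le_max_right _ _) (le_max_right _ _)) hβ
  have hβ7 : β₇ ≤ β := le_trans (le_trans (le_max_left _ _) (le_max_right _ _)) hβ
  have hμ0 : 0 ≤ a β / T := (div_pos (ha β) hT).le
  have hμ1 : a β / T ≤ 1 := by
    rw [div_le_one hT]
    exact hβ₇ β hβ7
  have hmain := hw β hβ0 (a β / T) C₀ 1 hμ0 hμ1 hC₀ _ hK hP S n hS hn
  have hexp : Real.exp (-(a β / T * n)) = Real.exp (-(1 / T * a β * n)) := by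
    congr 1
    ring
  rw [hexp] at hmain
  exact hmain

/-! ## §2 Per-β onset from one exit at tolerance `1/24` -/

/-- **Per-β onset from ONE exit** (group-blind, every `β ≥ 0`): a cold `4:1` torus of half-side `L ≥ 8` with purity
defect `≤ 1/24` gives an admissible cold-pressure length at that coupling — the abstract basin `1/24 → ε⋆` on Wilson's
family at `β`, then the explicit recursion fed to `coldPressureAt_of_exit_recursion` at the new exit scale. -/
theorem exists_coldPressureAt_of_coldDefect_le (r : LatticeRep G) {β : ℝ} (hβ0 : 0 ≤ β) {L : ℕ} (hL : 8 ≤ L)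
    (hδ : coldDefect r.ρ β L ≤ 1 / 24) : ∃ ξ : ℕ, 1 ≤ ξ ∧ ColdPressureAt r.ρ β ξ := by
  have hδ' := hδ
  rw [coldDefect_eq_boxDefect] at hδ'
  obtain ⟨L', hL', hδ''⟩ :=
    abstractBasin_24_epsStar _ (axisSymmetric r β) (tracePositive r hβ0) (volumeBounds r hβ0) L hL hδ'
  have hex : coldDefect r.ρ β L' ≤ 1 / (16 * max (2 ^ 20 : ℝ) 2) := by
    rw [coldDefect_eq_boxDefect]; exact hδ''
  have hrec : ∀ M : ℕ, 8 ≤ M → ∀ M' : ℕ, 2 * M ≤ M' → M' ≤ 4 * M →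
      coldDefect r.ρ β M' ≤ 2 ^ 20 * coldDefect r.ρ β M ^ 2 :=
    fun M hM M' h₁ h₂ => coldDefect_sq_le_two_pow r hβ0 M hM M' h₁ h₂
  have hLs : max 8 8 ≤ L' := by rw [max_self]; exact hL'
  exact ⟨L', by omega, coldPressureAt_of_exit_recursion r hβ0 (by norm_num) hrec hLs hex⟩

/-! ## §3 The cofinal bill's kernel: the gap family on the set of exiting couplings -/

/-- **`GapInUnits` ON THE SET OF EXITING COUPLINGS from the AF pin alone** (compact simple `G`, Borel σ-algebra as in
the leaf): with `E_r := {β | 0 ≤ β ∧ ∃ L ≥ 8, coldDefect r.ρ β L ≤ 1/24}`, `LowerBounds G r a` and `AFToColdPressure`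
give one rate `c₁ > 0`, a threshold and species-uniform constants for the clustering bound at every `β ∈ E_r` past the
threshold.  Per-β throughout: onset at `β ∈ E_r` (§2), the pincer `cp_pinned` (all `β`), the rate seam (§1). -/
theorem gapOn_exitSet_of_af (hX : AFToColdPressure)
    (G : Type) [Group G] [TopologicalSpace G] [IsTopologicalGroup G] [CompactSpace G]
    (hG : IsCompactSimpleLieGroup G) :
    letI : MeasurableSpace G := borel G
    haveI : BorelSpace G := ⟨rfl⟩
    ∀ (r : LatticeRep G) (a : ℝ → ℝ), (∀ β, 0 < a β) → Tendsto a atTop (𝓝 0) → LowerBounds G r a →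
      ∃ (c₁ β₂ : ℝ) (S₁ : ℝ → ℕ), 0 < c₁ ∧ ∀ A B : YMSpecies G, ∃ C : ℝ,
        ∀ β ∈ {β : ℝ | 0 ≤ β ∧ ∃ L : ℕ, 8 ≤ L ∧ coldDefect r.ρ β L ≤ 1 / 24}, β₂ ≤ β →
          ∀ S n : ℕ, S₁ β ≤ S → n ≤ S →
            |latticeConnectedCorr r.ρ β (2 * S + 1) A.F B.F n| ≤ C * Real.exp (-(c₁ * a β * n)) := by
  letI : MeasurableSpace G := borel G
  haveI : BorelSpace G := ⟨rfl⟩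
  intro r a ha ha0 hlb
  obtain ⟨T, β₆, hpin⟩ := cp_pinned r a ha hlb (hX G hG r)
  have hon : ∀ β ∈ {β : ℝ | 0 ≤ β ∧ ∃ L : ℕ, 8 ≤ L ∧ coldDefect r.ρ β L ≤ 1 / 24}, (0 : ℝ) ≤ β →
      ∃ ξ : ℕ, 1 ≤ ξ ∧ ColdPressureAt r.ρ β ξ := by
    rintro β ⟨hβ0, L, hL, hδ⟩ _
    exact exists_coldPressureAt_of_coldDefect_le r hβ0 hL hδ
  exact gapOn_of_coldPressure_pinned_on r a ha ha0 _ hon hpin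

end Summit.QuantumFields.YangMills.Cruxes.IR.ColdPressurePincer

end
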